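/-
  FunctionalMining / NoGo — two-notch STRICT K rule book: the CLOCKWORK laws and the TWO-LEVEL PALETTE THEOREM
  (COLLAPSE-ADDENDUM-4 add-3, nogo g17 rider 3). Finite / algebraic cores only; the kinematic layer (exact tangent
  velocities, delay line, time reversal) stays prose in the md. search for candidate a priori estimates; no regularity claim.

  Content.
  §A  flat-limit channel constants as field identities: the GAP-LAW ratio is η₂/(t+u) for both channel types
      (`rhoG_flat`, `rhoF_flat`), the dead-channel CONVEYOR factor is 1 (`kappa_flat`); the bookkeeping of the OFFSET
      RECURSION F21 (`offset_recursion`) and of the DELAY LINE F19 (`delay_step`); the incompatibility behind the main law (M)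
      (`no_double_pin`).
  §B  the abstract PROPAGATION / PALETTE theorem, for block sequences of ANY length: channel states in the five-letter alphabet,
      signs s_i = ±1 with (M) "χ = s at live channels" and the propagation rule s_{i+1} = ε̂(R_i) ε̂(L_{i+1}) s_i, levels
      V_{i+1} = V_i + c(R_i) + c(L_{i+1}); then 2 V_i − s_i is constant (`invariant`), every level present on block i is
      (I ± 1)/2 (`level_classes`), any two levels differ by ≤ 1 (`spread_le_one`), so no K4′ case (≥ 3, 4, 4, 5) is met
      (`no_K4_case`). Induction, no `decide`.
  §C  cross-check by `decide` at p = 3: the main law (M) alone ("live channels of a −d main have equal χ") already excludes all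
      201 K-static three-block patterns (`lawM_kills_p3`).
-/
import Mathlib
import HarnessLib

namespace Summit.NavierStokesRegularity.FunctionalMining.TwoNotchClockwork

/-! ## §A  flat constants and bookkeeping identities -/

/-- GAP LAW, type G (LAG), flat limit: β′_G / α_G = ((d+u)/(t+u)) / ((d+u)/(t−u)) = (t−u)/(t+u) = η₂/(t+u). -/
theorem rhoG_flat (d t u : ℝ) (hdu : d + u ≠ 0) (htu : t + u ≠ 0) (htu' : t - u ≠ 0) :
    ((d + u) / (t + u)) / ((d + u) / (t - u)) = (t - u) / (t + u) := by
  field_simp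

/-- GAP LAW, type F (FRONTHOOD), flat limit: α_F / β′_F = ((d−u)/(t+u)) / ((d−u)/(t−u)) = (t−u)/(t+u) = η₂/(t+u). -/
theorem rhoF_flat (d t u : ℝ) (hdu : d - u ≠ 0) (htu : t + u ≠ 0) (htu' : t - u ≠ 0) :
    ((d - u) / (t + u)) / ((d - u) / (t - u)) = (t - u) / (t + u) := by
  field_simp

/-- both types give the SAME flat ratio (so one λ = log((t+u)/η₂) serves all live channels). -/
theorem rho_flat_eq (d t u : ℝ) (hdu : d + u ≠ 0) (hdu' : d - u ≠ 0) (htu : t + u ≠ 0) (htu' : t - u ≠ 0) :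
    ((d + u) / (t + u)) / ((d + u) / (t - u)) = ((d - u) / (t + u)) / ((d - u) / (t - u)) := by
  rw [rhoG_flat d t u hdu htu htu', rhoF_flat d t u hdu' htu htu']

/-- the flat ratio is < 1 (0 < u < t). -/
theorem rho_flat_lt_one (t u : ℝ) (hu : 0 < u) (hut : u < t) : (t - u) / (t + u) < 1 := by
  rw [div_lt_one (by linarith)]; linarith

/-- CONVEYOR factor κ = (s_B · c′_slow)/(g_A · c′_fast), flat limit: ((d+t)/2 · (d−t)/2) / ((d−t)/2 · (d+t)/2) = 1. -/
theorem kappa_flat (d t : ℝ) (h1 : d + t ≠ 0) (h2 : d - t ≠ 0) :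
    ((d + t) / 2 * ((d - t) / 2)) / ((d - t) / 2 * ((d + t) / 2)) = 1 := by
  rw [mul_comm]; exact div_self (by positivity)

/-- OFFSET RECURSION F21 (bookkeeping): the first absorption height of g computed from the behind side
(y + Δ₀ + θ' + α Δ₀) and from the ahead side (y + Δ₀ + Δ + θ + (g_A/e₀) Δ) agree, hence θ = θ' + α Δ₀ − (1 + g_A/e₀) Δ. -/
theorem offset_recursion (y Δ₀ Δ θ θ' α gA e₀ σ₁ : ℝ)
    (h_behind : σ₁ = y + Δ₀ + θ' + α * Δ₀) (h_ahead : σ₁ = y + Δ₀ + Δ + θ + gA / e₀ * Δ) :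
    θ = θ' + α * Δ₀ - (1 + gA / e₀) * Δ := by
  have : y + Δ₀ + θ' + α * Δ₀ = y + Δ₀ + Δ + θ + gA / e₀ * Δ := by rw [← h_behind, ← h_ahead]
  linarith

/-- GAP LAW from the recursion summed over a period: if the offsets return (Σ increments = 0) then α·Y₀ = β′·Y₁. -/
theorem gap_law (α β' Y₀ Y₁ : ℝ) (h : α * Y₀ - β' * Y₁ = 0) : α * Y₀ = β' * Y₁ := by linarith

/-- DELAY LINE F19 (induction step): emission j+1 rests at p + v (τ' − τ); g leaves p at height τ + T with the same speed v,
so at height τ' + T it is exactly there. -/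
theorem delay_step (p v τ τ' T : ℝ) : p + v * ((τ' + T) - (τ + T)) = p + v * (τ' - τ) := by ring

/-- FINAL GAP after e events: G₀ + (V_e − V₀) T with V_e = V₀ for e even. -/
theorem final_gap_even (G₀ V₀ T : ℝ) : G₀ + (V₀ - V₀) * T = G₀ := by ring

/-- the incompatibility behind (M): two live channels of the same type would pin a = ρ₁ b and b = ρ₂ a with
0 < ρ₁, ρ₂ < 1 and a, b > 0 — impossible. -/
theorem no_double_pin (a b ρ₁ ρ₂ : ℝ) (ha : 0 < a) (hb : 0 < b) (h1 : ρ₁ < 1) (h2 : ρ₂ < 1)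
    (e1 : a = ρ₁ * b) (e2 : b = ρ₂ * a) : False := by
  have hab : a < b := by nlinarith
  have hba : b < a := by nlinarith
  linarith

/-- sign version used in §B: a live channel pins log r to +λ or −λ (λ > 0); two pins at one main must have the same sign. -/
theorem pins_agree (x lam : ℝ) (hl : 0 < lam) (s₁ s₂ : ℤ) (h1 : s₁ = 1 ∨ s₁ = -1) (h2 : s₂ = 1 ∨ s₂ = -1)
    (e1 : x = s₁ * lam) (e2 : x = s₂ * lam) : s₁ = s₂ := by
  rcases h1 with h1 | h1 <;> rcases h2 with h2 | h2 <;> subst h1 <;> subst h2 <;> push_cast at e1 e2 <;>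
    first | rfl | (exfalso; linarith)

/-- conveyor through a run: if |x₀| ≥ λ, |x_m| ≥ λ, x_m = (−1)^m x₀ + E with |E| < 2λ, then sign x_m = (−1)^m sign x₀
(stated for m odd / even via σ = ±1). -/
theorem run_sign (x₀ xm E lam σ : ℝ) (hl : 0 < lam) (hσ : σ = 1 ∨ σ = -1) (hx : xm = σ * x₀ + E) (hE : |E| < 2 * lam)
    (h0 : lam ≤ |x₀|) (hm : lam ≤ |xm|) : 0 < xm * (σ * x₀) := by
  rcases hσ with hσ | hσ <;> subst hσ <;>
  · rcases abs_lt.mp hE with ⟨hE1, hE2⟩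
    rcases le_abs.mp h0 with h0 | h0 <;> rcases le_abs.mp hm with hm | hm <;> nlinarith

/-! ## §B  the abstract propagation / palette theorem (any number of blocks) -/

/-- static channel state: dead, or (parity, first chirality χ). -/
inductive CS
  | dead | evenP | evenM | oddP | oddM
  deriving DecidableEq, Repr

namespace CS

/-- first chirality χ of the channel: 0 if dead, +1 for the P states, −1 for the M states. -/
def chi : CS → ℤ
  | dead => 0 | evenP => 1 | evenM => -1 | oddP => 1 | oddM => -1

/-- parity weight π: 1 for an odd (live) channel, 0 for an even or a dead one. -/
def par : CS → ℤ
  | oddP => 1 | oddM => 1 | _ => 0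

/-- a channel is live unless it is `dead`. -/
def live : CS → Bool
  | dead => false | _ => true

/-- charges (ADD-4 F14(3)): c(R) = −χπ, c(L) = +χπ -/
def cR (s : CS) : ℤ := -(s.chi * s.par)
/-- charge of an L channel (ADD-4 F14(3)): c(L) = +χπ. -/
def cL (s : CS) : ℤ := s.chi * s.par

/-- ε̂(C): +1 for a live odd channel, −1 for a live even or a dead channel (propagation lemma of add-3 §7). -/
def eps : CS → ℤ
  | oddP => 1 | oddM => 1 | _ => -1

/-- the u-levels met on a channel adjacent to a main with base level V: {V} if dead, {V, V − χ} if live -/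
def vals (V : ℤ) (s : CS) : List ℤ := if s.live then [V, V - s.chi] else [V]

/-- the five channel states as a list (for the `decide` enumerations of §C). -/
def all : List CS := [dead, evenP, evenM, oddP, oddM]

end CS

/-- A (finite piece of a) block sequence with its sign data: L i, R i the channels of the i-th −d main, V i its base
level, s i = ±1 its gap-ratio sign; hypotheses = (M), the propagation rule ((P)+(C)), and the level recursion. -/
structure SignedPattern where
  L : ℕ → CS
  R : ℕ → CS
  V : ℕ → ℤ
  s : ℕ → ℤ
  sign : ∀ i, s i = 1 ∨ s i = -1
  lawM_L : ∀ i, (L i).live = true → (L i).chi = s i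
  lawM_R : ∀ i, (R i).live = true → (R i).chi = s i
  prop : ∀ i, s (i + 1) = (R i).eps * (L (i + 1)).eps * s i
  levels : ∀ i, V (i + 1) = V i + (R i).cR + (L (i + 1)).cL

namespace SignedPattern

variable (X : SignedPattern)

/-- one step of the invariant 2V − s. -/
theorem step (i : ℕ) : 2 * X.V (i + 1) - X.s (i + 1) = 2 * X.V i - X.s i := by
  have hs := X.sign i
  have hP := X.prop i
  have hV := X.levels i
  have hR := X.lawM_R i
  have hL := X.lawM_L (i + 1)
  rcases hRi : X.R i with _ | _ | _ | _ | _ <;> rcases hLi : X.L (i + 1) with _ | _ | _ | _ | _ <;>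
    simp only [hRi, hLi, CS.live, CS.chi, CS.par, CS.cR, CS.cL, CS.eps, forall_const] at hP hV hR hL <;>
    rcases hs with hs | hs <;> omega

/-- THEOREM R₇ core: 2 V_i − s_i is constant along the sequence. -/
theorem invariant (i : ℕ) : 2 * X.V i - X.s i = 2 * X.V 0 - X.s 0 := by
  induction i with
  | zero => rfl
  | succ n ih => rw [X.step n, ih]

/-- the odd integer I := 2 V₀ − s₀. -/
def I : ℤ := 2 * X.V 0 - X.s 0

/-- every level present on block i (on either channel) is (I + s_i)/2 or (I − s_i)/2, i.e. 2ℓ = I ± 1. -/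
theorem level_classes (i : ℕ) (ℓ : ℤ) (h : ℓ ∈ CS.vals (X.V i) (X.L i) ++ CS.vals (X.V i) (X.R i)) :
    2 * ℓ = X.I + 1 ∨ 2 * ℓ = X.I - 1 := by
  have hinv := X.invariant i
  have hs := X.sign i
  have hR := X.lawM_R i
  have hL := X.lawM_L i
  simp only [I]
  rcases hRi : X.R i with _ | _ | _ | _ | _ <;> rcases hLi : X.L i with _ | _ | _ | _ | _ <;>
    simp only [hRi, hLi, CS.vals, CS.live, CS.chi, forall_const, List.mem_append, List.mem_cons,
      List.not_mem_nil, or_false, if_true, if_false, Bool.false_eq_true] at h hR hL <;>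
    rcases hs with hs | hs <;> omega

/-- TWO-LEVEL PALETTE: any two levels anywhere in the sequence differ by at most 1 (in units of u). -/
theorem spread_le_one (i j : ℕ) (ℓ ℓ' : ℤ)
    (h : ℓ ∈ CS.vals (X.V i) (X.L i) ++ CS.vals (X.V i) (X.R i))
    (h' : ℓ' ∈ CS.vals (X.V j) (X.L j) ++ CS.vals (X.V j) (X.R j)) : ℓ - ℓ' ≤ 1 := by
  have h1 := X.level_classes i ℓ h
  have h2 := X.level_classes j ℓ' h'
  omega

/-- hence no K4′ case: (L,R) needs a difference ≥ 3, (L,L)/(R,R) ≥ 4, (R,L) ≥ 5 between two levels (R₂‴, add-1). -/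
theorem no_K4_case (i j : ℕ) (ℓ ℓ' : ℤ)
    (h : ℓ ∈ CS.vals (X.V i) (X.L i) ++ CS.vals (X.V i) (X.R i))
    (h' : ℓ' ∈ CS.vals (X.V j) (X.L j) ++ CS.vals (X.V j) (X.R j)) : ¬ (3 ≤ ℓ - ℓ') := by
  have := X.spread_le_one i j ℓ ℓ' h h'
  omega

/-- osc V ≤ 1 as well. -/
theorem oscV_le_one (i j : ℕ) : X.V i - X.V j ≤ 1 := by
  have h1 := X.invariant i
  have h2 := X.invariant j
  rcases X.sign i with hi | hi <;> rcases X.sign j with hj | hj <;> omega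

end SignedPattern

/-! ## §C  p = 3 cross-check: the main law (M) alone empties the 201 K-static patterns -/

/-- maximum of a list of levels (sentinel −1000 on the empty list; lists here are nonempty and small). -/
def maxL (l : List ℤ) : ℤ := l.foldr max (-1000)
/-- minimum of a list of levels (sentinel 1000 on the empty list). -/
def minL (l : List ℤ) : ℤ := l.foldr min 1000

/-- the four profile spreads (max L − min R, max L − min L, max R − min R, max R − min L) of the level lists met on the
L side and on the R side. -/
def spreads (Lv Rv : List ℤ) : ℤ × ℤ × ℤ × ℤ :=
  (maxL Lv - minL Rv, maxL Lv - minL Lv, maxL Rv - minL Rv, maxL Rv - minL Lv)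

/-- the K4′ case analysis: a pattern meets K4′ if one of the four spreads reaches its threshold (≥ 3, 4, 4, 5). -/
def meetsK4 (q : ℤ × ℤ × ℤ × ℤ) : Bool :=
  decide (3 ≤ q.1) || decide (4 ≤ q.2.1) || decide (4 ≤ q.2.2.1) || decide (5 ≤ q.2.2.2)

/-- a three-block pattern is closed (y-periodic) if the six channel charges sum to zero. -/
def closed3 (L1 R1 L2 R2 L3 R3 : CS) : Bool :=
  decide (R1.cR + L2.cL + R2.cR + L3.cL + R3.cR + L1.cL = 0)

/-- the four spreads of a three-block pattern, base level of block 1 normalised to 0 and the later base levels obtained from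
the level recursion V_{i+1} = V_i + c(R_i) + c(L_{i+1}). -/
def spreads3 (L1 R1 L2 R2 L3 R3 : CS) : ℤ × ℤ × ℤ × ℤ :=
  let V2 := R1.cR + L2.cL
  let V3 := V2 + R2.cR + L3.cL
  spreads (CS.vals 0 L1 ++ CS.vals V2 L2 ++ CS.vals V3 L3) (CS.vals 0 R1 ++ CS.vals V2 R2 ++ CS.vals V3 R3)

/-- law (M) violated at a block: both channels live with different χ. -/
def badM (L R : CS) : Bool := L.live && R.live && decide (L.chi ≠ R.chi)

/-- exhaustive enumeration over the 5⁶ three-block channel assignments: every closed pattern meeting K4′ has a block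
violating law (M) (`decide`). -/
theorem lawM_kills_p3_all :
    (CS.all.all fun L1 => CS.all.all fun R1 => CS.all.all fun L2 => CS.all.all fun R2 => CS.all.all fun L3 =>
      CS.all.all fun R3 =>
        (!closed3 L1 R1 L2 R2 L3 R3 || !meetsK4 (spreads3 L1 R1 L2 R2 L3 R3) ||
          badM L1 R1 || badM L2 R2 || badM L3 R3)) = true := by
  decide

/-- `CS.all` lists every channel state. -/
theorem CS.mem_all (s : CS) : s ∈ CS.all := by cases s <;> decide

/-- p = 3: every closed K-static pattern contains a −d main violating (M). -/
theorem lawM_kills_p3 (L1 R1 L2 R2 L3 R3 : CS) (hc : closed3 L1 R1 L2 R2 L3 R3 = true)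
    (hk : meetsK4 (spreads3 L1 R1 L2 R2 L3 R3) = true) :
    badM L1 R1 = true ∨ badM L2 R2 = true ∨ badM L3 R3 = true := by
  have H := lawM_kills_p3_all
  simp only [List.all_eq_true] at H
  have h := H L1 (CS.mem_all _) R1 (CS.mem_all _) L2 (CS.mem_all _) R2 (CS.mem_all _) L3 (CS.mem_all _) R3 (CS.mem_all _)
  simp only [hc, hk, Bool.not_true, Bool.false_or, Bool.or_eq_true] at h
  tauto

end Summit.NavierStokesRegularity.FunctionalMining.TwoNotchClockwork
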